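import Mathlib
import HarnessLib
import Literature.MathematicalPhysics.QuantumManyBody.PeriodicBoseGasScattering
import Literature.MathematicalPhysics.QuantumManyBody.BoseGasFreeDirichletBEC
import Literature.MathematicalPhysics.QuantumManyBody.DirichletBoxGap
import Literature.MathematicalPhysics.QuantumManyBody.BoseGasFreeProductState
import Literature.MathematicalPhysics.QuantumManyBody.JelliumBoseGasCondensateDilation
import Literature.MathematicalPhysics.QuantumManyBody.FreeDirichletGap
import Summits.AtomisticToContinuum.BoseEinsteinCondensation.Theorems.NumberPhaseSandwichLossBookkeepingCells

/-!
# GapWindowLadder — the free-case door `GapWindowResponseFree` (stmt-AtomisticToContinuum-28031), part 1/4: MODES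

Route `route-AtomisticToContinuum-GapWindowLadder`, split gen 1 of the declared residual `GapWindowResponse`
(stmt-AtomisticToContinuum-27583) into `GapWindowResponseFree` (zero scattering length) and `GapWindowResponsePos`
(positive scattering length, the residual); decomp-a2c lens-6 g14. This part: (1) zero scattering length means no
interaction (`energy v = energy 0`, `E₀(v) = E₀(0)`; LSSY App. C); (2) the SHARP free upper bound `E₀(0,N,L) ≤ 3π²N/L²` for every
`L > 0` (dilation covariance); (3) the `L²`-normalised sine ground mode `s` of the box `Λ_L` and its measurability /
normalisation; (4) the one-body Dirichlet gap `6(π/L)²‖f‖² ≤ ∫|∇f|² + 3(π/L)²|⟨s,f⟩|²` transported from `Fin 3 → ℝ` to `ℝ³`.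

THE FREE GAP-WINDOW LAW (the whole argument, spread over the four files `GapWindowLadderFreeWindowModes`,
`GapWindowLadderFreeWindowCells`, `GapWindowLadderFreeWindowParseval`, `GapWindowLadderFreeWindow`). For a repulsive
finite-range `v` with `scatteringLength v = 0` the interaction vanishes a.e. (LSSY App. C, `LSSY2005_zeroScatteringLength_holds`),
so `energy v = energy 0` and the claim is about the free Dirichlet gas in `Λ_L`, `L = L_N = (N/ρ)^{1/3}`. For EVERY state `Φ`
and every dyadic level `k ≥ 1` (cells of side `ℓ = L/2^k`):

  `(1/L²) · 16⁻¹ Σ_c Σ_{c' sibling ≠ c} ⟨u_c − u_{c'}, γ_Φ (u_c − u_{c'})⟩ ≤ (E − E₀) + (1/L²) e(K,k) N`,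

with `κ = 1` and the allowance table `e(K,k) = (5/4)(F_k − F_{k−1}) + 2^{-k}/100`, `F_m = (φ_m)³`,
`φ_m = (2^{m+1}/π²) Σ_{j<2^m} (cos(πj/2^m) − cos(π(j+1)/2^m))²` (the coarse-grained mass of the sine ground mode at
level `m`; `F_0 = (8/π²)³`, `F_m ↑ ≤ 1`), rows `Σ_{k ≤ K} e(K,k) ≤ (5/4)(1 − (8/π²)³) + 2/100 ≤ 3/4`.

Proof: slice `Φ(·,Y) = c(Y) s + r_Y` along the sine ground mode `s` of the box; the sibling pair loss of the `c s` part is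
`16 |c(Y)|² (F_k − F_{k−1})` exactly (Parseval over the 8 children of each parent cell), the `r` part contributes at most
`160 ∫|r_Y|²` to the pair sum (Young with `η = 1/4`: `|x+y+w|² ≤ (5/4)x² + 10y² + 10w²`, Cauchy–Schwarz on each cell,
8 children per parent), and `∫|c(Y)|² dY ≤ 1`; the one-body Dirichlet gap of the cube
(`DirichletBox.gap_mul_lintegral_enorm_sq_le_pi`, transported to `ℝ³`) gives `3(π/L)²(‖Φ_Y‖² + ‖r_Y‖²) ≤ ∫|∇ₓΦ(·,Y)|²`
slice-wise, hence `N·(3π²/L²)·∫‖r_Y‖² dY ≤ E − 3π²N/L² ≤ E − E₀` by the SHARP free upper bound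
`E₀(0,N,L) ≤ 3π²N/L²` (`groundStateEnergy_zero_le_of_ge` + exact dilation covariance `groundStateEnergy_dilate`);
finally `10 ≤ 3π²`.

Only BUILT modules are imported (`NumberPhaseSandwichLossBookkeepingCells` for the dyadic parent/children combinatorics
`par`, `children`, exactly as `GapWindowLadderLossBookkeeping` already does); (4b) collects every definition of the four files
(`σ₁`, `s`, `Δcos`, `φ_m`, `F_m`, the cell masses `a_q`, `F_m(L)`, `G_k(L)`, the table `e(k)`), so that parts 2–4 are theorem-only.
-/

noncomputable section

namespace Summit.AtomisticToContinuum.BoseEinsteinCondensation.Theorems.GapWindowLadderFreeWindowModes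

open scoped BigOperators Topology ENNReal NNReal ComplexConjugate
open Filter MeasureTheory Set
open Literature.MathematicalPhysics.QuantumManyBody.BoseGas
open Literature.MathematicalPhysics.QuantumManyBody.NeumannBox
open Literature.MathematicalPhysics.QuantumManyBody.DirichletBox
open Summit.AtomisticToContinuum.BoseEinsteinCondensation.Theorems.NumberPhaseSandwichLossBookkeepingCells

/-! ## 1. Zero scattering length means no interaction -/

section ZeroScattering

/-- **Zero scattering length means no interaction**: `energy v Ψ = energy 0 Ψ` — the interaction vanishes for a.e.
configuration (for `i ≠ j` the map `X ↦ Xᵢ − Xⱼ` is a linear surjection, so it pulls null sets back to null sets).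
[cite: LSSY2005, App. C, Thm. C.1] -/
theorem energy_eq_energy_zero {v : ℝ → ℝ≥0∞} (hv : IsRepulsiveFiniteRange v)
    (h0 : scatteringLength v = 0) (N : ℕ) (L : ℝ) (Ψ : TrialState N L) : energy v Ψ = energy 0 Ψ := by
  obtain ⟨hmeas, R₀, hR₀⟩ := hv
  have hae : ∀ᵐ x : Space, v ‖x‖ = 0 := LSSY2005_zeroScatteringLength_holds v R₀ hmeas hR₀ h0
  -- for `i ≠ j`, `v(|Xᵢ − Xⱼ|) = 0` for a.e. configuration
  have hpair : ∀ {i j : Fin N}, i ≠ j → ∀ᵐ X : Config N, v ‖X i - X j‖ = 0 := by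
    intro i j hij
    have hs : MeasurableSet {y : Space | v ‖y‖ = 0} :=
      hmeas.comp measurable_norm (measurableSet_singleton 0)
    let T : Config N →ₗ[ℝ] Space :=
      LinearMap.proj (R := ℝ) (φ := fun _ : Fin N => Space) i -
        LinearMap.proj (R := ℝ) (φ := fun _ : Fin N => Space) j
    have hT : Function.Surjective T := fun y =>
      ⟨Pi.single i y, by simp [T, Pi.single_eq_of_ne hij.symm]⟩
    have h := (ae_comp_linearMap_mem_iff T volume volume hT hs).2 hae
    filter_upwards [h] with X hX
    simpa [T] using hX
  have hall : ∀ᵐ X : Config N, ∀ i j : Fin N, i ≠ j → v ‖X i - X j‖ = 0 := by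
    refine ae_all_iff.2 fun i => ae_all_iff.2 fun j => ?_
    by_cases hij : i = j
    · exact Filter.Eventually.of_forall fun X h => absurd hij h
    · exact (hpair hij).mono fun X hX _ => hX
  have h1 : ∀ᵐ X : Config N, interaction v X = 0 := by
    refine hall.mono fun X hX => ?_
    unfold interaction
    refine Finset.sum_eq_zero fun i _ => Finset.sum_eq_zero fun j hj => ?_
    rw [dist_eq_norm]
    exact hX i j (Finset.mem_filter.1 hj).2.ne
  have h2 : ∀ X : Config N, interaction (0 : ℝ → ℝ≥0∞) X = 0 := fun X => by
    unfold interaction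
    simp
  unfold energy
  refine lintegral_congr_ae ?_
  filter_upwards [h1] with X hX
  rw [hX, h2]

/-- … hence also `E₀(v, N, L) = E₀(0, N, L)`. -/
theorem groundStateEnergy_eq_zero {v : ℝ → ℝ≥0∞} (hv : IsRepulsiveFiniteRange v)
    (h0 : scatteringLength v = 0) (N : ℕ) (L : ℝ) : groundStateEnergy v N L = groundStateEnergy 0 N L := by
  unfold groundStateEnergy
  exact iInf_congr fun Ψ => energy_eq_energy_zero hv h0 N L Ψ

end ZeroScattering

/-! ## 2. The sharp free upper bound `E₀(0, N, L) ≤ 3π²N/L²` for every `L > 0` -/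

section FreeUpper

/-- `E₀(0,N,L) ≤ 3N(π/L)²(1+η)` for EVERY `L > 0`: the large-box bound transported by the exact dilation covariance. -/
theorem groundStateEnergy_zero_le_eta {L : ℝ} (hL : 0 < L) (N : ℕ) {η : ℝ} (hη : 0 < η) :
    groundStateEnergy 0 N L ≤ ENNReal.ofReal (3 * N * (Real.pi / L) ^ 2 * (1 + η)) := by
  obtain ⟨L₀, hL₀, H⟩ := groundStateEnergy_zero_le_of_ge hη
  have hL₁ : 0 < max L₀ L := lt_of_lt_of_le hL (le_max_right _ _)
  have hs : 0 < L / max L₀ L := div_pos hL hL₁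
  have h1 := H (max L₀ L) (le_max_left _ _) N
  have h2 := Literature.MathematicalPhysics.QuantumManyBody.JelliumBoseGas.groundStateEnergy_dilate
    (0 : ℝ → ℝ≥0∞) N (max L₀ L) hs
  rw [scalePotential_zero, div_mul_cancel₀ L hL₁.ne'] at h2
  rw [h2]
  calc ENNReal.ofReal ((L / max L₀ L) ^ 2)⁻¹ * groundStateEnergy 0 N (max L₀ L)
      ≤ ENNReal.ofReal ((L / max L₀ L) ^ 2)⁻¹ *
          ENNReal.ofReal (3 * N * (Real.pi / max L₀ L) ^ 2 * (1 + η)) := by gcongr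
    _ = ENNReal.ofReal (3 * N * (Real.pi / L) ^ 2 * (1 + η)) := by
        rw [← ENNReal.ofReal_mul (inv_nonneg.2 (sq_nonneg _))]
        congr 1
        field_simp

/-- **The sharp free upper bound** `E₀(0, N, L) ≤ 3N(π/L)²` (`L > 0`). -/
theorem groundStateEnergy_zero_le_sharp {L : ℝ} (hL : 0 < L) (N : ℕ) :
    groundStateEnergy 0 N L ≤ ENNReal.ofReal (3 * N * (Real.pi / L) ^ 2) := by
  refine ENNReal.le_of_forall_pos_le_add fun ε hε _ => ?_
  set A : ℝ := 3 * N * (Real.pi / L) ^ 2 with hA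
  have hA0 : 0 ≤ A := by positivity
  have hε' : 0 < (ε : ℝ) := by exact_mod_cast hε
  have hη : 0 < (ε : ℝ) / (A + 1) := div_pos hε' (by linarith)
  calc groundStateEnergy 0 N L ≤ ENNReal.ofReal (A * (1 + ε / (A + 1))) :=
        groundStateEnergy_zero_le_eta hL N hη
    _ ≤ ENNReal.ofReal (A + ε) := by
        refine ENNReal.ofReal_le_ofReal ?_
        have h1 : A * ((ε : ℝ) / (A + 1)) ≤ ε := by
          rw [mul_div_assoc', div_le_iff₀ (by linarith)]
          nlinarith
        nlinarith
    _ = ENNReal.ofReal A + ε := by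
        rw [ENNReal.ofReal_add hA0 hε'.le, ENNReal.ofReal_coe_nnreal]

end FreeUpper

/-! ## 3. The sine ground mode of the box `Λ_L` -/

section SineMode

/-- the one-dimensional ground profile `σ_L(t) = (2/L)^{1/2} sin(πt/L)`. -/
def sigma1 (L t : ℝ) : ℝ := Real.sqrt (2 / L) * Real.sin (Real.pi * t / L)

/-- the sine ground mode `s_L = 1_{Λ_L} ∏ᵢ σ_L(xᵢ)` of the Dirichlet box `Λ_L = (0,L)³`. -/
def sineMode (L : ℝ) (x : Space) : ℂ :=
  (box L).indicator (fun x => ((∏ i : Fin 3, sigma1 L (x i) : ℝ) : ℂ)) x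

/-- the one-dimensional sine mode `σ₁` is continuous. -/
theorem continuous_sigma1 (L : ℝ) : Continuous (sigma1 L) := by
  unfold sigma1; fun_prop

/-- `σ₁(0) = 0`. -/
theorem sigma1_zero (L : ℝ) : sigma1 L 0 = 0 := by simp [sigma1]

/-- the product `x ↦ ∏ᵢ σ₁(xᵢ)` is continuous on `ℝ³`. -/
theorem continuous_prodSigma (L : ℝ) : Continuous fun x : Space => ((∏ i : Fin 3, sigma1 L (x i) : ℝ) : ℂ) := by
  refine Complex.continuous_ofReal.comp ?_
  exact continuous_finsetProd _ fun i _ => (continuous_sigma1 L).comp (PiLp.continuous_apply 2 _ i)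

/-- the sine mode vanishes off the box. -/
theorem sineMode_of_not_mem {L : ℝ} {x : Space} (hx : x ∉ box L) : sineMode L x = 0 := by
  simp [sineMode, Set.indicator_of_notMem hx]

/-- the sine mode on the box is the product of the one-dimensional modes. -/
theorem sineMode_of_mem {L : ℝ} {x : Space} (hx : x ∈ box L) :
    sineMode L x = ((∏ i : Fin 3, sigma1 L (x i) : ℝ) : ℂ) := by
  simp [sineMode, Set.indicator_of_mem hx]

/-- on the half-open cell `[0,L)³` the indicator is invisible (`σ_L(0) = 0`). -/
theorem sineMode_of_mem_cell {L : ℝ} {x : Space} (hx : x ∈ cell L) :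
    sineMode L x = ((∏ i : Fin 3, sigma1 L (x i) : ℝ) : ℂ) := by
  by_cases hb : x ∈ box L
  · exact sineMode_of_mem hb
  · rw [sineMode_of_not_mem hb]
    obtain ⟨i, hi⟩ : ∃ i, x i ∉ Set.Ioo (0 : ℝ) L := by
      by_contra h
      push Not at h
      exact hb h
    have hx0 : x i = 0 := by
      have h1 := hx i
      rcases eq_or_lt_of_le h1.1 with h | h
      · exact h.symm
      · exact absurd ⟨h, h1.2⟩ hi
    symm
    rw [Complex.ofReal_eq_zero]
    exact Finset.prod_eq_zero (Finset.mem_univ i) (by rw [hx0, sigma1_zero])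

/-- the sine mode is a.e. strongly measurable. -/
theorem aestronglyMeasurable_sineMode (L : ℝ) : AEStronglyMeasurable (sineMode L) volume :=
  (continuous_prodSigma L).aestronglyMeasurable.indicator (measurableSet_box L)

/-- the sine mode is measurable. -/
theorem measurable_sineMode (L : ℝ) : Measurable (sineMode L) :=
  (continuous_prodSigma L).measurable.indicator (measurableSet_box L)

/-- the sine mode is bounded by `√(2/L)³`. -/
theorem norm_sineMode_le {L : ℝ} (x : Space) : ‖sineMode L x‖ ≤ Real.sqrt (2 / L) ^ 3 := by
  unfold sineMode
  refine (norm_indicator_le_norm_self _ _).trans ?_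
  rw [Complex.norm_real, Real.norm_eq_abs, Finset.abs_prod]
  calc ∏ i : Fin 3, |sigma1 L (x i)| ≤ ∏ _i : Fin 3, Real.sqrt (2 / L) := by
        refine Finset.prod_le_prod (fun i _ => abs_nonneg _) fun i _ => ?_
        unfold sigma1
        rw [abs_mul, abs_of_nonneg (Real.sqrt_nonneg _)]
        exact mul_le_of_le_one_right (Real.sqrt_nonneg _) (Real.abs_sin_le_one _)
    _ = Real.sqrt (2 / L) ^ 3 := by rw [Finset.prod_const, Finset.card_univ, Fintype.card_fin]

/-- `∫_{[0,L]³} ∏ᵢ σ_L(yᵢ)² dy = 1`. -/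
theorem integral_Icc_prod_sigma1_sq {L : ℝ} (hL : 0 < L) :
    ∫ y in Set.Icc (0 : Fin 3 → ℝ) (fun _ => L), ∏ i : Fin 3, sigma1 L (y i) ^ 2 = 1 := by
  rw [← Set.pi_univ_Icc, volume_pi, Measure.restrict_pi_pi]
  rw [integral_fintype_prod_eq_prod (𝕜 := ℝ) (fun (_ : Fin 3) (t : ℝ) => sigma1 L t ^ 2)]
  have h1 : ∫ t in Set.Icc (0 : ℝ) L, sigma1 L t ^ 2 = 1 := by
    rw [integral_Icc_eq_integral_Ioc, ← intervalIntegral.integral_of_le hL.le]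
    have h2 : (fun t => sigma1 L t ^ 2) = fun t => 2 / L * Real.sin (Real.pi * t / L) ^ 2 := by
      funext t
      rw [sigma1, mul_pow, Real.sq_sqrt (by positivity)]
    rw [h2]
    exact integral_two_div_mul_sin_sq hL
  simp [h1]

/-- **The sine mode is normalised**: `∫ |s_L|² = 1` (`L > 0`). -/
theorem lintegral_sineMode_sq {L : ℝ} (hL : 0 < L) : ∫⁻ x, ‖sineMode L x‖ₑ ^ 2 = 1 := by
  have hsupp : Function.support (fun x => ‖sineMode L x‖ₑ ^ 2) ⊆ box L := by
    intro x hx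
    by_contra hb
    exact hx (by simp [sineMode_of_not_mem hb])
  rw [← setLIntegral_eq_of_support_subset hsupp]
  have h1 : ∫⁻ x in box L, ‖sineMode L x‖ₑ ^ 2 =
      ∫⁻ x in box L, ENNReal.ofReal (∏ i : Fin 3, sigma1 L (x i) ^ 2) := by
    refine setLIntegral_congr_fun (measurableSet_box L) fun x hx => ?_
    rw [sineMode_of_mem hx, ← ofReal_norm, ← ENNReal.ofReal_pow (norm_nonneg _), Complex.norm_real,
      Real.norm_eq_abs, sq_abs, ← Finset.prod_pow]
  rw [h1, setLIntegral_box_eq_lintegral_Icc]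
  dsimp only
  have hint : IntegrableOn (fun y : Fin 3 → ℝ => ∏ i : Fin 3, sigma1 L (y i) ^ 2)
      (Set.Icc (0 : Fin 3 → ℝ) fun _ => L) volume := by
    refine ContinuousOn.integrableOn_compact isCompact_Icc (Continuous.continuousOn ?_)
    exact continuous_finsetProd _ fun i _ => ((continuous_sigma1 L).comp (continuous_apply i)).pow 2
  rw [← ofReal_integral_eq_lintegral_ofReal hint
      (ae_of_all _ fun y => Finset.prod_nonneg fun i _ => sq_nonneg _), integral_Icc_prod_sigma1_sq hL,
    ENNReal.ofReal_one]

end SineMode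

/-! ## 4. The one-body Dirichlet gap of the box, transported to `ℝ³` -/

section Gap

/-- **One-body Dirichlet gap in `ℝ³` form**: for `f ∈ C¹(ℝ³)` vanishing off `Λ_L`,
`6(π/L)² ∫|f|² ≤ ∫|∇f|² + 3(π/L)² |⟨s_L, f⟩|²` (ground level `3(π/L)²`, first excited level `6(π/L)²`). -/
theorem oneBodyGap {L : ℝ} (hL : 0 < L) {f : Space → ℂ} (hf : ContDiff ℝ 1 f)
    (hf0 : ∀ x, x ∉ box L → f x = 0) :
    ENNReal.ofReal (6 * (Real.pi / L) ^ 2) * ∫⁻ x, ‖f x‖ₑ ^ 2 ≤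
      (∫⁻ x, gradSqC f x) +
        ENNReal.ofReal (3 * (Real.pi / L) ^ 2) * ‖∫ x, conj (sineMode L x) * f x‖ₑ ^ 2 := by
  have hgC : ContDiff ℝ 1 fun y : Fin 3 → ℝ => f (WithLp.toLp 2 y) := hf.comp PiLp.contDiff_toLp
  have hbd : ∀ (z : Fin 3 → ℝ) (b : Fin 3), z b = 0 ∨ z b = L → f (WithLp.toLp 2 z) = 0 := by
    intro z b hz
    refine hf0 _ fun hmem => ?_
    have h1 : (WithLp.toLp 2 z : Space) b ∈ Set.Ioo (0 : ℝ) L := hmem b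
    dsimp only at h1
    rcases hz with h | h
    · rw [h] at h1; exact lt_irrefl _ h1.1
    · rw [h] at h1; exact lt_irrefl _ h1.2
  have key := gap_mul_lintegral_enorm_sq_le_pi (ι := Fin 3) hL hgC hbd
  -- (M) mass
  have hsupp : Function.support (fun x => ‖f x‖ₑ ^ 2) ⊆ box L := by
    intro x hx
    by_contra hb
    exact hx (by simp [hf0 x hb])
  have hM : ∫⁻ z in Set.Icc (0 : Fin 3 → ℝ) (fun _ => L), ‖f (WithLp.toLp 2 z)‖ₑ ^ 2 = ∫⁻ x, ‖f x‖ₑ ^ 2 := by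
    rw [← setLIntegral_box_eq_lintegral_Icc L (fun x => ‖f x‖ₑ ^ 2), setLIntegral_eq_of_support_subset hsupp]
  -- (T) kinetic
  have hT : ∫⁻ z in Set.Icc (0 : Fin 3 → ℝ) (fun _ => L),
      ∑ b, ‖fderiv ℝ (fun y : Fin 3 → ℝ => f (WithLp.toLp 2 y)) z (Pi.single b 1)‖ₑ ^ 2 ≤ ∫⁻ x, gradSqC f x := by
    simp_rw [fderiv_comp_toLp_single]
    rw [← setLIntegral_box_eq_lintegral_Icc L (fun x => ∑ b, ‖fderiv ℝ f x (EuclideanSpace.single b 1)‖ₑ ^ 2)]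
    calc ∫⁻ x in box L, ∑ b, ‖fderiv ℝ f x (EuclideanSpace.single b 1)‖ₑ ^ 2
        ≤ ∫⁻ x, ∑ b, ‖fderiv ℝ f x (EuclideanSpace.single b 1)‖ₑ ^ 2 := setLIntegral_le_lintegral _ _
      _ = ∫⁻ x, gradSqC f x := by
          refine lintegral_congr fun x => ?_
          simp only [gradSqC, enorm_eq_nnnorm]
  -- (C) the ground coefficient
  have hsin : ∀ t : ℝ, Real.sqrt (2 / L) * Real.sin (waveNumber L 1 * t) = sigma1 L t := fun t => by
    simp only [sigma1, waveNumber, Nat.cast_one, one_mul]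
    ring_nf
  have hC : ∫ z in Set.Icc (0 : Fin 3 → ℝ) (fun _ => L),
      ((∏ b, Real.sqrt (2 / L) * Real.sin (waveNumber L 1 * z b) : ℝ) : ℂ) * f (WithLp.toLp 2 z) =
        ∫ x, conj (sineMode L x) * f x := by
    have h1 : (fun x => conj (sineMode L x) * f x) =
        (box L).indicator fun x => ((∏ i : Fin 3, sigma1 L (x i) : ℝ) : ℂ) * f x := by
      funext x
      by_cases hx : x ∈ box L
      · rw [Set.indicator_of_mem hx, sineMode_of_mem hx, Complex.conj_ofReal]
      · rw [Set.indicator_of_notMem hx, sineMode_of_not_mem hx, map_zero, zero_mul]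
    rw [h1, integral_indicator (measurableSet_box L), setIntegral_box_eq_integral_Icc]
    refine setIntegral_congr_fun measurableSet_Icc fun z _ => ?_
    simp only [hsin]
  have hcard : ((Fintype.card (Fin 3) : ℕ) : ℝ) + 3 = 6 := by norm_num
  rw [hM, hC, hcard] at key
  exact key.trans (add_le_add hT le_rfl)

end Gap

/-! ## 4b. The explicit objects of the free law (all definitions of the four files live here) -/

section Defs

/-- `Δcos_m(j) = cos(πj/2^m) − cos(π(j+1)/2^m)`. -/
def dcos (m j : ℕ) : ℝ := Real.cos (Real.pi * j / 2 ^ m) - Real.cos (Real.pi * (j + 1) / 2 ^ m)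

/-- `φ_m = (2^{m+1}/π²) Σ_{j<2^m} Δcos_m(j)²`, the coarse-grained mass of the 1-D sine mode at level `m`. -/
def sinePhi (m : ℕ) : ℝ := ∑ j ∈ Finset.range (2 ^ m), 2 ^ (m + 1) / Real.pi ^ 2 * dcos m j ^ 2

/-- `F_m = φ_m³`, the coarse-grained mass of the sine ground mode of the cube at level `m`. -/
def Fexp (m : ℕ) : ℝ := sinePhi m ^ 3

/-- the cell masses `a_q = ∫_{Q_q} s_L` at dyadic level `m` (`2^{3m}` cells of side `L/2^m`). -/
def cellMass (L : ℝ) (m : ℕ) (q : SubIdx (2 ^ m)) : ℂ := ∫ x in subCell (L / 2 ^ m) q, sineMode L x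



/-- the level-`m` coarse-grained mass `F_m(L) = ℓ_m⁻³ Σ_q |a_q|²`, real form. -/
def Freal (L : ℝ) (m : ℕ) : ℝ := ((L / 2 ^ m) ^ 3)⁻¹ * ∑ q : SubIdx (2 ^ m), ‖cellMass L m q‖ ^ 2

/-- the sibling pair loss of the sine mode at level `k`, real form:
`G_k(L) = 16⁻¹ ℓ_k⁻³ Σ_P Σ_{c,c' children of P} |a_c − a_{c'}|²`. -/
def Greal (L : ℝ) (k : ℕ) : ℝ :=
  16⁻¹ * (((L / 2 ^ k) ^ 3)⁻¹ * ∑ P : SubIdx (2 ^ (k - 1)), ∑ c ∈ children P, ∑ c' ∈ children P,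
    ‖cellMass L k c - cellMass L k c'‖ ^ 2)

/-- the allowance table of the free law (independent of the window index `K`):
`e(k) = (5/4)(F_k − F_{k−1}) + 2^{-k}/100`. -/
def eTab (k : ℕ) : ℝ := 5 / 4 * (Fexp k - Fexp (k - 1)) + (1 / 2) ^ k / 100

end Defs

end Summit.AtomisticToContinuum.BoseEinsteinCondensation.Theorems.GapWindowLadderFreeWindowModes
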